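import Literature.NumberTheory.LFunctions.FeketePolyaKernelCertificates
import Literature.NumberTheory.LFunctions.NoRealZeroOddSmallModuli
import HarnessLib

/-!
# No real zero for the ODD real primitive characters of conductor `≤ 231`, in the kernel
# (`NoRealZeroOddUpTo 231`; with the even base `292`: `NoRealZeroUpTo 231`, unconditionally)

Topic `Literature/NumberTheory/LFunctions`; namespace `Literature.NumberTheory.LFunctions`
(helpers in `….OddSmallModuliII`). THEOREMS only (no definition, no named fact, no `sorry`).

The odd kernel base of the no-real-zero column was `163` (`noRealZeroOddUpTo_onehundredsixtythree`:
Epstein class sums with `k ≤ 32/5`, which stop at `√q/2 < 7.0055…`, Bateman–Grosswald). Here it is pushed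
to `231` by the order-two Fekete–Pólya criterion through INDUCED characters (engine
`FeketePolyaKernelCertificates.lean`, as for the even side in `NoRealZeroEvenSmallModuli.lean`):
**`noRealZeroOddUpTo_231 : NoRealZeroOddUpTo 231`**. With `noRealZeroEvenUpTo_292` (sibling file, not
imported here so that the two files build independently) this gives `NoRealZeroUpTo 231` both parities —
the two-line corollary is left to the file that imports both.

The `19` negative fundamental discriminants `−d`, `163 < d ≤ 231`, pass with `k = 1` except `d = 211`
(`k = 2`), `228` (`k = 5`) and `187 = 11·17` (`k = 390 = 2·3·5·13`, period `72 930`; `h(−187) = 2` — the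
hardest row, ≈ 90 s of kernel time). The next odd discriminants `−232`, `−235`, `−267` (class number `2`)
admit NO Fekete–Pólya certificate of order `≤ 3` and period `≤ 3·10⁵` through `k ∣ 510510`
(Heilbronn's phenomenon, `Literature.Barriers.RiemannHypothesis.FeketePolyaPositivity`; numerics of the
cell, 2026-08-26): the method's frontier on the odd side is `231`, and `232` would need Low's
Epstein-sum method (M. E. Low, Acta Arith. 14 (1968)), not in the tree.

## References

* H. L. Montgomery, R. C. Vaughan, *Multiplicative Number Theory I*, CUP 2007, §11.2.1 Exercises 7–8,
  §9.3 Theorem 9.13. [MontgomeryVaughan2007]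
* J. B. Rosser, *Real roots of real Dirichlet L-series*, J. Research Nat. Bur. Standards 45 (1950)
  505–514. [Rosser1950RealRoots]
* P. T. Bateman, E. Grosswald, *On Epstein's zeta function*, Acta Arith. 9 (1964) 365–373. [BatemanGrosswald1964]
-/

namespace Literature.NumberTheory.LFunctions

namespace OddSmallModuliII

open FeketePolyaKernel PrimitiveQuadratic

/-- Primitive characters of modulus `≥ 2` are non-trivial. [folklore] -/
private theorem ne_one {q : ℕ} [NeZero q] {χ : DirichletCharacter ℂ q} (hprim : χ.IsPrimitive)
    (hq : 2 ≤ q) : χ ≠ 1 :=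
  SiegelZeroQuality.ne_one_of_isPrimitive hprim hq


/-- Conductor `≡ 2 (mod 4)`: no primitive character (private twin of the even file's lemma).
[cite: MontgomeryVaughan2007, §9.3 Theorem 9.13] -/
private theorem absurd_of_mod_four_two {q : ℕ} [NeZero q] (hq : q % 4 = 2)
    {χ : DirichletCharacter ℂ q} (hprim : χ.IsPrimitive) : False := by
  obtain ⟨m, rfl⟩ : ∃ m, q = 2 * m := ⟨q / 2, by omega⟩
  haveI : NeZero m := ⟨by omega⟩
  exact not_isPrimitive_two_mul (m := m) (Nat.odd_iff.mpr (by omega)) hprim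

/-- Conductor divisible by `16`: no primitive quadratic character (private twin).
[cite: MontgomeryVaughan2007, §9.3 Theorem 9.13] -/
private theorem absurd_of_sixteen_dvd {q : ℕ} [NeZero q] (hq : q % 16 = 0) {χ : DirichletCharacter ℂ q}
    (hprim : χ.IsPrimitive) (hquad : χ.IsQuadratic) : False := by
  obtain ⟨k, m, hm, rfl⟩ := Nat.exists_eq_two_pow_mul_odd (NeZero.ne q)
  have hm2 := Nat.odd_iff.mp hm
  haveI : NeZero m := ⟨by omega⟩
  have hk := le_three_of_level_two_pow_mul hm hprim hquad
  interval_cases k <;> norm_num at hq <;> omega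

/-- Conductor with an odd square factor `p²`: no primitive quadratic character (private twin).
[cite: MontgomeryVaughan2007, §9.3 Theorem 9.13] -/
private theorem absurd_of_sq_dvd {q : ℕ} [NeZero q] {p : ℕ} (hp : p.Prime) (hp2 : p ≠ 2)
    (hpq : p * p ∣ q) {χ : DirichletCharacter ℂ q} (hprim : χ.IsPrimitive) (hquad : χ.IsQuadratic) :
    False := by
  obtain ⟨k, m, hm, rfl⟩ := Nat.exists_eq_two_pow_mul_odd (NeZero.ne q)
  have hm2 := Nat.odd_iff.mp hm
  haveI : NeZero m := ⟨by omega⟩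
  have hsq := squarefree_of_level_two_pow_mul hm hprim hquad
  have hp2' : Nat.Coprime p 2 := (Nat.coprime_primes hp Nat.prime_two).mpr hp2
  have hcop : Nat.Coprime (p * p) (2 ^ k) := Nat.Coprime.pow_right k (Nat.Coprime.mul_left hp2' hp2')
  have hpm : p * p ∣ m := hcop.dvd_of_dvd_mul_left hpq
  exact hp.one_lt.ne' (Nat.isUnit_iff.mp (hsq p hpm))

/-- Parity test: if `ℜχ(n) = v(n)` for all `n` and `v(q − 1) = +1`, then `χ` is not odd
(`χ(−1) = χ(q − 1)`). [cite: MontgomeryVaughan2007, §4.2] -/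
theorem not_odd_of_val {q : ℕ} [NeZero q] {χ : DirichletCharacter ℂ q} (v : ℕ → ℤ)
    (hv : ∀ n : ℕ, (χ (n : ZMod q)).re = v n) (hpos : v (q - 1) = 1) : ¬ χ.Odd := by
  intro hodd
  have hq : 1 ≤ q := NeZero.one_le
  have hcast : ((q - 1 : ℕ) : ZMod q) = -1 := by
    rw [Nat.cast_sub hq, ZMod.natCast_self, Nat.cast_one, zero_sub]
  have h := hv (q - 1)
  rw [hcast, hodd, Complex.neg_re, Complex.one_re, hpos] at h
  norm_num at h

/-- **Odd characters of odd conductor `q > 1`**: parity test (`((q−1)/q) = +1`: no odd primitive quadratic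
character mod `q`) or order-two certificate of the induced character mod `qk`.
[cite: MontgomeryVaughan2007, §11.2.1 Exercises 7 (g), 8] -/
theorem good_odd_of_odd {q : ℕ} [NeZero q] (hq2 : q % 2 = 1) (hq1 : 1 < q) (k : ℕ) (hk : k ≠ 0)
    (h : valOdd q (q - 1) = 1 ∨ runOK (valOdd q) (q * k) = true) :
    ∀ χ : DirichletCharacter ℂ q, χ.IsQuadratic → χ.IsPrimitive → χ.Odd →
      ∀ σ : ℝ, 0 < σ → σ < 1 → χ.LFunction σ ≠ 0 := by
  intro χ hquad hprim hodd σ hσ _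
  have hv := re_apply_eq_valOdd (Nat.odd_iff.mpr hq2) hq1 hprim hquad
  rcases h with hpar | hrun
  · exact (not_odd_of_val _ hv hpar hodd).elim
  · haveI : NeZero (q * k) := ⟨Nat.mul_ne_zero (NeZero.ne q) hk⟩
    exact lfunction_ne_zero_of_check (dvd_mul_right q k) χ _ hv (ne_one hprim hq1)
      (check_of_runOK hrun) hσ

/-- **Odd characters of conductor `4m`**, keyed on `q = 4m`: parity test or certificate.
[cite: MontgomeryVaughan2007, §11.2.1 Exercises 7 (g), 8] -/
theorem good_odd_of_four {q : ℕ} [NeZero q] (hq8 : q % 8 = 4) (hq1 : 4 < q) (k : ℕ) (hk : k ≠ 0)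
    (h : valFour (q / 4) (q - 1) = 1 ∨ runOK (valFour (q / 4)) (q * k) = true) :
    ∀ χ : DirichletCharacter ℂ q, χ.IsQuadratic → χ.IsPrimitive → χ.Odd →
      ∀ σ : ℝ, 0 < σ → σ < 1 → χ.LFunction σ ≠ 0 := by
  obtain ⟨m, rfl⟩ : ∃ m, q = 4 * m := ⟨q / 4, by omega⟩
  haveI : NeZero m := ⟨by omega⟩
  rw [Nat.mul_div_cancel_left m (by norm_num : 0 < 4)] at h
  intro χ hquad hprim hodd σ hσ _
  have hv := re_apply_eq_valFour (m := m) (Nat.odd_iff.mpr (by omega)) (by omega) hprim hquad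
  rcases h with hpar | hrun
  · exact (not_odd_of_val _ hv hpar hodd).elim
  · haveI : NeZero (4 * m * k) := ⟨Nat.mul_ne_zero (NeZero.ne _) hk⟩
    exact lfunction_ne_zero_of_check (dvd_mul_right _ k) χ _ hv (ne_one hprim (by omega))
      (check_of_runOK hrun) hσ

/-- **Odd characters of conductor `8m`**, keyed on `q = 8m`: for each of the two value patterns, parity
test or certificate. [cite: MontgomeryVaughan2007, §11.2.1 Exercises 7 (g), 8] -/
theorem good_odd_of_eight {q : ℕ} [NeZero q] (hq16 : q % 16 = 8) (hq1 : 8 < q) (k : ℕ) (hk : k ≠ 0)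
    (hA : valEightA (q / 8) (q - 1) = 1 ∨ runOK (valEightA (q / 8)) (q * k) = true)
    (hB : valEightB (q / 8) (q - 1) = 1 ∨ runOK (valEightB (q / 8)) (q * k) = true) :
    ∀ χ : DirichletCharacter ℂ q, χ.IsQuadratic → χ.IsPrimitive → χ.Odd →
      ∀ σ : ℝ, 0 < σ → σ < 1 → χ.LFunction σ ≠ 0 := by
  obtain ⟨m, rfl⟩ : ∃ m, q = 8 * m := ⟨q / 8, by omega⟩
  haveI : NeZero m := ⟨by omega⟩
  rw [Nat.mul_div_cancel_left m (by norm_num : 0 < 8)] at hA hB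
  intro χ hquad hprim hodd σ hσ _
  haveI : NeZero (8 * m * k) := ⟨Nat.mul_ne_zero (NeZero.ne _) hk⟩
  rcases re_apply_eq_valEight (m := m) (Nat.odd_iff.mpr (by omega)) (by omega) hprim hquad with hv | hv
  · rcases hA with hpar | hrun
    · exact (not_odd_of_val _ hv hpar hodd).elim
    · exact lfunction_ne_zero_of_check (dvd_mul_right _ k) χ _ hv (ne_one hprim (by omega))
        (check_of_runOK hrun) hσ
  · rcases hB with hpar | hrun
    · exact (not_odd_of_val _ hv hpar hodd).elim
    · exact lfunction_ne_zero_of_check (dvd_mul_right _ k) χ _ hv (ne_one hprim (by omega))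
        (check_of_runOK hrun) hσ

/-- Odd conductors `163 < q ≤ 231` (one combinator: conductor lemmas, then certificates with `k ↑`;
`k = 390` is reached only by `q = 187`). [cite: MontgomeryVaughan2007, §11.2.1 Exercises 7 (g), 8] -/
theorem range_164_231 (q : ℕ) [NeZero q] (hlo : 163 < q) (hhi : q ≤ 231) :
    ∀ χ : DirichletCharacter ℂ q, χ.IsQuadratic → χ.IsPrimitive → χ.Odd →
      ∀ σ : ℝ, 0 < σ → σ < 1 → χ.LFunction σ ≠ 0 := by
  interval_cases q
  all_goals first
    | exact fun χ _ hprim _ _ _ _ ↦ (absurd_of_mod_four_two (by decide) hprim).elim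
    | exact fun χ hquad hprim _ _ _ _ ↦ (absurd_of_sixteen_dvd (by decide) hprim hquad).elim
    | exact fun χ hquad hprim _ _ _ _ ↦
        (absurd_of_sq_dvd (p := 3) (by norm_num) (by decide) (by decide) hprim hquad).elim
    | exact fun χ hquad hprim _ _ _ _ ↦
        (absurd_of_sq_dvd (p := 5) (by norm_num) (by decide) (by decide) hprim hquad).elim
    | exact fun χ hquad hprim _ _ _ _ ↦
        (absurd_of_sq_dvd (p := 7) (by norm_num) (by decide) (by decide) hprim hquad).elim
    | exact fun χ hquad hprim _ _ _ _ ↦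
        (absurd_of_sq_dvd (p := 13) (by norm_num) (by decide) (by decide) hprim hquad).elim
    | exact good_odd_of_odd (by decide) (by decide) 1 (by decide) (by decide +kernel)
    | exact good_odd_of_odd (by decide) (by decide) 2 (by decide) (by decide +kernel)
    | exact good_odd_of_odd (by decide) (by decide) 390 (by decide) (by decide +kernel)
    | exact good_odd_of_four (by decide) (by decide) 1 (by decide) (by decide +kernel)
    | exact good_odd_of_four (by decide) (by decide) 5 (by decide) (by decide +kernel)
    | exact good_odd_of_eight (by decide) (by decide) 1 (by decide) (by decide +kernel) (by decide +kernel)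

end OddSmallModuliII

open OddSmallModuliII in
/-- **`NoRealZeroOddUpTo 231`, unconditionally**: no odd real primitive character of conductor `≤ 231`
has a real zero in `(0, 1)` (`q ≤ 163`: `noRealZeroOddUpTo_onehundredsixtythree`; `163 < q ≤ 231`:
order-two Fekete–Pólya certificates through induced characters, kernel-checked).
[cite: MontgomeryVaughan2007, §11.2.1 Exercises 7 (g), 8] -/
theorem noRealZeroOddUpTo_231 : NoRealZeroOddUpTo 231 := by
  intro q _ hq3 hq χ hquad hprim hodd σ hσ0 hσ1
  by_cases h163 : q ≤ 163
  · exact noRealZeroOddUpTo_onehundredsixtythree q hq3 h163 χ hquad hprim hodd σ hσ0 hσ1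
  · exact range_164_231 q (by omega) hq χ hquad hprim hodd σ hσ0 hσ1

end Literature.NumberTheory.LFunctions
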